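import Literature.Probability.Percolation.EnhancedCluster
import HarnessLib

/-!
# The local modification lemma (Martineau–Severo 2019, Lemma 6.1) for the enhanced cluster

Fourth file of the inline proof of `Literature.Probability.Percolation.MartineauSevero2019_cor22`.
Martineau–Severo (Ann. Probab. 47 (2019), §6):

> **Lemma 6.1.** There are constants `R` and `L₀` such that the following holds. If `L ≥ L₀` and an
> edge `e` is `p`-pivotal for `𝓔_L` in a configuration `(ω,α)`, then there exist a configuration
> `(ω',α')` differing from `(ω,α)` only inside `B_R(e)` and a vertex `z` in `B_R(e)` such that `z` is
> `s`-pivotal for `𝓔_L` in `(ω',α')`.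

We prove it (`exists_local_modification`) for the cluster `enhCluster` / event `enhEvent` of
`EnhancedCluster.lean` on a connected locally finite graph, with `L₀ = r + 1` and the window
`modWindow` (edges within `2r+2`, marks within `3r+4` of an endpoint of `e`; `z` within `3r+3`).
The proof is the printed one, organised as follows (`ω⁺ = ω ∪ {e}`):

* *removing marks* (`exists_pivotal_of_remove`): delete the marks near `e` one at a time; if `𝓔_L`
  is lost on the way, the last deleted mark is `s`-pivotal. Otherwise `α' = α ∖ B` has no mark near
  `e` and `e` is still pivotal.
* *an endpoint of `e` lies in `𝒞⁻ = 𝒞_o(ω⁺ ∖ e, α')`* (`subset_of_endpoints_not_mem`), hence at distance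
  `< L`; this replaces the printed "`e ⊆ B_L(o)`" (which is what it is used for). Call it `x`.
* *choice of `z`* (`exists_dist_eq_dist_sub`): on a geodesic from `o` to `x`, with `d(z,x) ≤ r` and
  `B_r(z) ⊆ B_{L-1}(o)` (Case a), `z = x` near the origin (Case b is absorbed: we allow `o ∈ B_r(z)`).
* *closing `B_{r+1}(z)`*: `ω̃ = ω⁺ ∖ E(B_{r+1}(z)) ⊆ ω⁺ ∖ e`; the first entrance of `𝒞_o(ω⁺,α')` into
  `B_{r+1}(z)` yields `u ∈ S_{r+1}(z) ∩ 𝒞_o(ω̃,α')` unless `o ∈ B_r(z)` (`first_entrance`, by induction on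
  the generation of the cluster — the printed "step `n-1` does not depend on the edges inside
  `B_{r+1}(z)`").
* *opening `B_r(z)` and the edge `u⁻u`*: `ω' = ω̃ ∪ E(B_r(z)) ∪ {u⁻u}`. Then
  `𝒞_o(ω',α') ⊆ 𝒞_o(ω̃,α') ∪ B_r(z)` misses distance `L` (`enhCluster_union_subset`), while with the
  extra mark at `z` the bonus fires and `𝒞_o(ω⁺,α') ⊆ 𝒞_o(ω', α' ∪ {z})` reaches it
  (`enhCluster_subset_of_ball_subset`): `z` is `s`-pivotal in `(ω', α')`.

## References

* S. Martineau, F. Severo, Ann. Probab. 47 (2019), §6, Lemma 6.1 and its proof [MartineauSevero2019].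
* M. Aizenman, G. Grimmett, J. Stat. Phys. 63 (1991) 817–835, Lemma 2 [AizenmanGrimmett1991].
-/

namespace Literature.Probability.Percolation

open Literature.Barriers.CriticalPhenomena

variable {W : Type*}

/-! ### Graph bookkeeping: distances and balls -/

section Graph

variable {H : SimpleGraph W}

/-- `dist ≤ n` from a ball membership (no connectivity needed). [folklore] -/
theorem dist_le_of_mem_graphBall {x y : W} {n : ℕ} (h : y ∈ graphBall H x n) : H.dist x y ≤ n := by
  obtain ⟨w, hw⟩ := h
  exact (SimpleGraph.dist_le w).trans hw

/-- Ball membership from `dist ≤ n` in a connected graph. [folklore] -/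
theorem mem_graphBall_of_dist_le (hH : H.Connected) {x y : W} {n : ℕ} (h : H.dist x y ≤ n) :
    y ∈ graphBall H x n := by
  obtain ⟨w, hw⟩ := hH.exists_walk_length_eq_dist x y
  exact ⟨w, hw ▸ h⟩

/-- Symmetry of balls. [folklore] -/
theorem mem_graphBall_symm {x y : W} {n : ℕ} (h : y ∈ graphBall H x n) : x ∈ graphBall H y n := by
  obtain ⟨w, hw⟩ := h
  exact ⟨w.reverse, by rw [SimpleGraph.Walk.length_reverse]; exact hw⟩

/-- Triangle inequality for balls. [folklore] -/
theorem mem_graphBall_trans {x y z : W} {m n : ℕ} (hy : y ∈ graphBall H x m) (hz : z ∈ graphBall H y n) :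
    z ∈ graphBall H x (m + n) := by
  obtain ⟨w₁, h₁⟩ := hy
  obtain ⟨w₂, h₂⟩ := hz
  exact ⟨w₁.append w₂, by rw [SimpleGraph.Walk.length_append]; omega⟩

/-- A neighbour lies in the unit ball. [folklore] -/
theorem mem_graphBall_one_of_adj' {x y : W} (h : H.Adj x y) : y ∈ graphBall H x 1 :=
  ⟨SimpleGraph.Walk.cons h SimpleGraph.Walk.nil, le_rfl⟩

/-- An edge with an endpoint in `B_m(z) ∩ B_n(u)`-type position: if `s(a,b)` lies in `E(B_n(u))` and in
`E(B_m(z))` then `u ∈ B_{n+m}(z)`. [folklore] -/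
theorem mem_graphBall_of_edgesInBall_inter {z u : W} {m n : ℕ} {e : Sym2 W} (hez : e ∈ edgesInBall H z m)
    (heu : e ∈ edgesInBall H u n) : u ∈ graphBall H z (m + n) := by
  induction e using Sym2.inductionOn with
  | hf a b =>
    have ha : a ∈ graphBall H z m := (mk_mem_edgesInBall_iff.1 hez).2.1
    have ha' : a ∈ graphBall H u n := (mk_mem_edgesInBall_iff.1 heu).2.1
    exact mem_graphBall_trans ha (mem_graphBall_symm ha')

/-- Splitting a walk at position `k`. [folklore] -/
theorem exists_walk_split {a b : W} (w : H.Walk a b) {k : ℕ} (hk : k ≤ w.length) :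
    ∃ z : W, (∃ w₁ : H.Walk a z, w₁.length = k) ∧ ∃ w₂ : H.Walk z b, w₂.length = w.length - k := by
  induction w generalizing k with
  | nil =>
    simp only [SimpleGraph.Walk.length_nil, Nat.le_zero] at hk
    subst hk
    exact ⟨_, ⟨SimpleGraph.Walk.nil, rfl⟩, SimpleGraph.Walk.nil, rfl⟩
  | @cons a c b hac w ih =>
    cases k with
    | zero => exact ⟨a, ⟨SimpleGraph.Walk.nil, rfl⟩, SimpleGraph.Walk.cons hac w, by simp⟩
    | succ k =>
      rw [SimpleGraph.Walk.length_cons] at hk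
      obtain ⟨z, ⟨w₁, hw₁⟩, w₂, hw₂⟩ := ih (k := k) (by omega)
      refine ⟨z, ⟨SimpleGraph.Walk.cons hac w₁, by rw [SimpleGraph.Walk.length_cons, hw₁]⟩, w₂, ?_⟩
      rw [hw₂, SimpleGraph.Walk.length_cons]
      omega

/-- **Points on a geodesic**: in a connected graph, for `k ≤ dist(o,x)` there is `z` with
`dist(o,z) = k` and `dist(z,x) = dist(o,x) - k`. [folklore] -/
theorem exists_dist_eq_dist_sub (hH : H.Connected) (o x : W) {k : ℕ} (hk : k ≤ H.dist o x) :
    ∃ z : W, H.dist o z = k ∧ H.dist z x = H.dist o x - k := by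
  obtain ⟨w, hw⟩ := hH.exists_walk_length_eq_dist o x
  obtain ⟨z, ⟨w₁, hw₁⟩, w₂, hw₂⟩ := exists_walk_split w (hw ▸ hk)
  have h1 : H.dist o z ≤ k := hw₁ ▸ SimpleGraph.dist_le w₁
  have h2 : H.dist z x ≤ H.dist o x - k := by rw [← hw, ← hw₂]; exact SimpleGraph.dist_le w₂
  have h3 : H.dist o x ≤ H.dist o z + H.dist z x := hH.dist_triangle
  refine ⟨z, ?_, ?_⟩ <;> omega

/-- **Predecessor on a geodesic**: if `dist(z,u) = k+1` then `u` has a neighbour in `B_k(z)`. [folklore] -/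
theorem exists_adj_mem_graphBall_of_dist_eq (hH : H.Connected) {z u : W} {k : ℕ} (h : H.dist z u = k + 1) :
    ∃ v : W, H.Adj v u ∧ v ∈ graphBall H z k := by
  obtain ⟨w, hw⟩ := hH.exists_walk_length_eq_dist u z
  rw [SimpleGraph.dist_comm, h] at hw
  cases w with
  | nil => simp at hw
  | cons hadj w' =>
    rw [SimpleGraph.Walk.length_cons] at hw
    exact ⟨_, hadj.symm, ⟨w'.reverse, by rw [SimpleGraph.Walk.length_reverse]; omega⟩⟩

/-- A point of `B_{k+1}(z) ∖ B_k(z)` is at distance exactly `k+1` (connected graph). [folklore] -/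
theorem dist_eq_of_mem_graphBall_of_not_mem (hH : H.Connected) {z u : W} {k : ℕ}
    (h1 : u ∈ graphBall H z (k + 1)) (h2 : u ∉ graphBall H z k) : H.dist z u = k + 1 := by
  have := dist_le_of_mem_graphBall h1
  have h' : ¬ H.dist z u ≤ k := fun h => h2 (mem_graphBall_of_dist_le hH h)
  omega

end Graph

/-! ### Closure tools for `𝒞_A(ω, α)` -/

section Closure

variable {H : SimpleGraph W} {r : ℕ}

/-- **Minimality**: `𝒞_A(ω,α)` is contained in every set containing `A` and closed under the two rules
(applied at points of the cluster). [cite: MartineauSevero2019, §4 (𝒞_o = ⋃ C_n)] -/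
theorem enhCluster_subset_of_closed {A : Set W} {ω : Set (Sym2 W)} {α : Set W} (T : Set W) (hA : A ⊆ T)
    (hedge : ∀ u v, u ∈ enhCluster H r A ω α → u ∈ T → H.Adj u v → s(u, v) ∈ ω → v ∈ T)
    (hbonus : ∀ u v, u ∈ enhCluster H r A ω α → u ∈ T → u ∈ α → edgesInBall H u r ⊆ ω →
      H.dist u v = r + 1 → v ∈ T) :
    enhCluster H r A ω α ⊆ T := fun _ hv =>
  enhCluster_induction (P := fun v => v ∈ T) (fun _ hv => hA hv) hedge hbonus hv

/-- **Walking inwards**: if `u ∈ 𝒞`, `u ∈ B_n(v)` and all edges of `B_n(v)` are open then `v ∈ 𝒞`.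
[cite: MartineauSevero2019, §6 ("B_r(z) is p-open")] -/
theorem mem_enhCluster_of_mem_graphBall {A : Set W} {ω : Set (Sym2 W)} {α : Set W} {u v : W} {n : ℕ}
    (hu : u ∈ enhCluster H r A ω α) (huv : u ∈ graphBall H v n) (hb : edgesInBall H v n ⊆ ω) :
    v ∈ enhCluster H r A ω α := by
  obtain ⟨w, hw⟩ := huv
  -- induction on the walk from `v` to `u`, generalizing the radius
  suffices h : ∀ (n : ℕ) (v u' : W) (w : H.Walk v u'), u' ∈ enhCluster H r A ω α → w.length ≤ n →
      edgesInBall H v n ⊆ ω → v ∈ enhCluster H r A ω α from h n v u w hu hw hb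
  intro n v u' w
  induction w generalizing n with
  | nil => intro hu' _ _; exact hu'
  | @cons a b c hab w' ih =>
    intro hu' hlen hball
    rw [SimpleGraph.Walk.length_cons] at hlen
    have hb1 : b ∈ graphBall H a 1 := mem_graphBall_one_of_adj' hab
    have hsub : edgesInBall H b (n - 1) ⊆ edgesInBall H a n := by
      rintro e ⟨he, hmem⟩
      refine ⟨he, ?_⟩
      induction e using Sym2.inductionOn with
      | hf p q =>
        have hp : p ∈ graphBall H a (1 + (n - 1)) := mem_graphBall_trans hb1 hmem.1
        have hq : q ∈ graphBall H a (1 + (n - 1)) := mem_graphBall_trans hb1 hmem.2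
        have h1n : 1 + (n - 1) = n := by omega
        rw [h1n] at hp hq
        exact ⟨hp, hq⟩
    have hbmem : b ∈ enhCluster H r A ω α := ih (n - 1) hu' (by omega) (hsub.trans hball)
    refine mem_enhCluster_of_adj hbmem hab.symm (hball ⟨hab.symm, ?_⟩)
    exact ⟨graphBall_mono H a (by omega) hb1, mem_graphBall_self H a n⟩

/-- If no endpoint of `e = s(x,y)` lies in `𝒞⁻ = 𝒞_A(ω ∖ e, α)`, a fully `ω`-open ball around a point of
`𝒞⁻` lies in `𝒞⁻` (the one missing edge `e` is never needed). [cite: MartineauSevero2019, §6 (proof of Lemma 6.1)] -/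
theorem graphBall_subset_of_endpoints_not_mem {A : Set W} {ω : Set (Sym2 W)} {α : Set W} {x y : W}
    (hx : x ∉ enhCluster H r A (ω \ {s(x, y)}) α) (hy : y ∉ enhCluster H r A (ω \ {s(x, y)}) α)
    {u : W} {n : ℕ} (hu : u ∈ enhCluster H r A (ω \ {s(x, y)}) α) (hb : edgesInBall H u n ⊆ ω) :
    graphBall H u n ⊆ enhCluster H r A (ω \ {s(x, y)}) α := by
  suffices h : ∀ k, k ≤ n → graphBall H u k ⊆ enhCluster H r A (ω \ {s(x, y)}) α from h n le_rfl
  intro k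
  induction k with
  | zero =>
    intro _ v hv
    rw [graphBall_zero, Set.mem_singleton_iff] at hv
    rw [hv]; exact hu
  | succ k ih =>
    intro hk v hv
    rcases (mem_graphBall_succ_iff' H u v k).1 hv with rfl | ⟨v', hv', hadj⟩
    · exact hu
    · have hv'mem := ih (Nat.le_of_succ_le hk) hv'
      have hin : s(v', v) ∈ ω :=
        hb ⟨hadj, graphBall_mono H u (Nat.le_of_succ_le hk) hv', graphBall_mono H u hk hv⟩
      refine mem_enhCluster_of_adj hv'mem hadj ⟨hin, ?_⟩
      rw [Set.mem_singleton_iff]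
      intro heq
      rcases Sym2.eq_iff.1 heq with ⟨rfl, rfl⟩ | ⟨rfl, rfl⟩
      · exact hx hv'mem
      · exact hy hv'mem

/-- **An endpoint of a pivotal edge lies in the smaller cluster**: if neither endpoint of
`e = s(x,y)` lies in `𝒞_A(ω ∖ e, α)` then `𝒞_A(ω, α) = 𝒞_A(ω ∖ e, α)` (the edge is never used, not even
by a bonus). [cite: MartineauSevero2019, §6 (proof of Lemma 6.1, "e is p-pivotal")] -/
theorem enhCluster_subset_of_endpoints_not_mem {A : Set W} {ω : Set (Sym2 W)} {α : Set W} {x y : W}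
    (hx : x ∉ enhCluster H r A (ω \ {s(x, y)}) α) (hy : y ∉ enhCluster H r A (ω \ {s(x, y)}) α) :
    enhCluster H r A ω α ⊆ enhCluster H r A (ω \ {s(x, y)}) α := by
  refine enhCluster_subset_of_closed _ (subset_enhCluster _ _ _ _ _) ?_ ?_
  · intro u v _ hu hadj he
    refine mem_enhCluster_of_adj hu hadj ⟨he, ?_⟩
    rw [Set.mem_singleton_iff]
    intro heq
    rcases Sym2.eq_iff.1 heq with ⟨rfl, rfl⟩ | ⟨rfl, rfl⟩
    · exact hx hu
    · exact hy hu
  · intro u v _ hu hα hb hd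
    refine mem_enhCluster_of_bonus hu hα (fun e he => ⟨hb he, ?_⟩) hd
    rw [Set.mem_singleton_iff]
    rintro rfl
    -- `e = s(x,y)` lies in `B_r(u)`, which is then inside `𝒞⁻`: contradiction
    have hxball : x ∈ graphBall H u r := (mk_mem_edgesInBall_iff.1 he).2.1
    exact hx (graphBall_subset_of_endpoints_not_mem hx hy hu hb hxball)

/-- **First entrance into `B_{r+1}(z)`.** Let `ω̃ = ω ∖ E(B_{r+1}(z))` and assume no mark of `α` lies in
`B_{2r+1}(z)`. Every vertex of `𝒞_o(ω, α)` either lies in `𝒞_o(ω̃, α)` outside `B_r(z)`, or some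
`u ∈ 𝒞_o(ω̃, α)` has `dist(z,u) = r+1`, or `o ∈ B_r(z)`.
[cite: MartineauSevero2019, §6 (proof of Lemma 6.1, Case a: the vertex u ∈ S_{r+1}(z) ∩ 𝒞_o(ω̃, α'))] -/
theorem first_entrance (hH : H.Connected) {o z : W} {ω : Set (Sym2 W)} {α : Set W}
    (hα : ∀ u ∈ α, u ∉ graphBall H z (2 * r + 1)) {v : W} (hv : v ∈ enhCluster H r {o} ω α) :
    (v ∈ enhCluster H r {o} (ω \ edgesInBall H z (r + 1)) α ∧ v ∉ graphBall H z r) ∨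
      (∃ u ∈ enhCluster H r {o} (ω \ edgesInBall H z (r + 1)) α, H.dist z u = r + 1) ∨
      o ∈ graphBall H z r := by
  set ω' := ω \ edgesInBall H z (r + 1) with hω'
  refine enhCluster_induction (P := fun v =>
    (v ∈ enhCluster H r {o} ω' α ∧ v ∉ graphBall H z r) ∨
      (∃ u ∈ enhCluster H r {o} ω' α, H.dist z u = r + 1) ∨ o ∈ graphBall H z r) ?_ ?_ ?_ hv
  · intro w hw
    rw [Set.mem_singleton_iff] at hw
    subst hw
    by_cases ho : w ∈ graphBall H z r
    · exact Or.inr (Or.inr ho)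
    · exact Or.inl ⟨subset_enhCluster _ _ _ _ _ rfl, ho⟩
  · rintro u w - (⟨hu, hur⟩ | hrest) hadj he
    · by_cases hin : s(u, w) ∈ edgesInBall H z (r + 1)
      · -- `u ∈ B_{r+1}(z) ∖ B_r(z)`: first entrance at `u`
        have hu1 : u ∈ graphBall H z (r + 1) := (mk_mem_edgesInBall_iff.1 hin).2.1
        exact Or.inr (Or.inl ⟨u, hu, dist_eq_of_mem_graphBall_of_not_mem hH hu1 hur⟩)
      · have hw : w ∈ enhCluster H r {o} ω' α := mem_enhCluster_of_adj hu hadj ⟨he, hin⟩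
        refine Or.inl ⟨hw, fun hwr => hin ⟨hadj, ?_, graphBall_mono H z (Nat.le_succ r) hwr⟩⟩
        have := mem_graphBall_trans hwr (mem_graphBall_one_of_adj' hadj.symm)
        exact this
    · exact Or.inr hrest
  · rintro u w - (⟨hu, -⟩ | hrest) hαu hb hd
    · have hfar : u ∉ graphBall H z (2 * r + 1) := hα u hαu
      have hb' : edgesInBall H u r ⊆ ω' := by
        intro e he
        rw [hω']
        refine ⟨hb he, fun hez => hfar ?_⟩
        have := mem_graphBall_of_edgesInBall_inter hez he
        have h2 : r + 1 + r = 2 * r + 1 := by ring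
        rw [h2] at this
        exact this
      have hw : w ∈ enhCluster H r {o} ω' α := mem_enhCluster_of_bonus hu hαu hb' hd
      refine Or.inl ⟨hw, fun hwr => hfar ?_⟩
      have h1 : w ∈ graphBall H u (r + 1) := mem_graphBall_of_dist_le hH hd.le
      have := mem_graphBall_trans hwr (mem_graphBall_symm h1)
      have h2 : r + (r + 1) = 2 * r + 1 := by ring
      rw [h2] at this
      exact this
    · exact Or.inr hrest

/-- **Upper bound for the modified cluster.** If `ω̃` has no edge inside `B_{r+1}(z)`, every edge of `F`
has an endpoint in `B_r(z)` and both endpoints in `B_r(z) ∪ 𝒞_o(ω̃,α)`, and `α` has no mark in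
`B_{2r}(z)`, then `𝒞_o(ω̃ ∪ F, α) ⊆ 𝒞_o(ω̃, α) ∪ B_r(z)`.
[cite: MartineauSevero2019, §6 (proof of Lemma 6.1: "𝒞_o(ω', α') = 𝒞_o(ω̃, α') ∪ B_r(z)")] -/
theorem enhCluster_union_subset {o z : W} {ω F : Set (Sym2 W)} {α : Set W}
    (hω : ∀ e ∈ ω, e ∉ edgesInBall H z (r + 1))
    (hF1 : ∀ e ∈ F, ∀ v ∈ e, v ∈ graphBall H z r ∨ v ∈ enhCluster H r {o} ω α)
    (hF2 : ∀ e ∈ F, ∃ v ∈ e, v ∈ graphBall H z r)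
    (hα : ∀ u ∈ α, u ∉ graphBall H z (2 * r)) :
    enhCluster H r {o} (ω ∪ F) α ⊆ enhCluster H r {o} ω α ∪ graphBall H z r := by
  refine enhCluster_subset_of_closed _ ?_ ?_ ?_
  · exact (subset_enhCluster _ _ _ _ _).trans Set.subset_union_left
  · rintro u v - hu hadj (he | he)
    · rcases hu with hu | hu
      · exact Or.inl (mem_enhCluster_of_adj hu hadj he)
      · -- an `ω̃`-edge from `B_r(z)` would lie inside `B_{r+1}(z)`
        exfalso
        refine hω _ he ⟨hadj, graphBall_mono H z (Nat.le_succ r) hu, ?_⟩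
        exact mem_graphBall_trans hu (mem_graphBall_one_of_adj' hadj)
    · exact (hF1 _ he v (Sym2.mem_mk_right u v)).elim Or.inr Or.inl
  · rintro u v - hu hαu hb hd
    have hfar := hα u hαu
    have hu' : u ∈ enhCluster H r {o} ω α := by
      rcases hu with hu | hu
      · exact hu
      · exact absurd (graphBall_mono H z (by omega) hu) hfar
    refine Or.inl (mem_enhCluster_of_bonus hu' hαu (fun e he => ?_) hd)
    rcases hb he with he' | he'
    · exact he'
    · exfalso
      obtain ⟨w, hw, hwz⟩ := hF2 e he'
      refine hfar ?_
      have hwu : w ∈ graphBall H u r := by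
        have := he.2
        induction e using Sym2.inductionOn with
        | hf a b =>
          rcases Sym2.mem_iff.1 hw with rfl | rfl
          · exact this.1
          · exact this.2
      have := mem_graphBall_trans hwz (mem_graphBall_symm hwu)
      have h2 : r + r = 2 * r := by ring
      rw [h2] at this
      exact this

/-- **Lower bound with the bonus at `z`.** If `B_{r+1}(z) ⊆ 𝒞' := 𝒞_o(ω', α'')`, `ω ⊆ ω' ∪ E(B_{r+1}(z))`,
`α ⊆ α''` and `α` has no mark in `B_{2r+1}(z)`, then `𝒞_o(ω, α) ⊆ 𝒞'`.
[cite: MartineauSevero2019, §6 (proof of Lemma 6.1: "𝒞_o(ω,α') ⊆ 𝒞_{B_{r+1}(z) ∪ {o}}(ω', α' ∪ {z})")] -/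
theorem enhCluster_subset_of_ball_subset {o z : W} {ω ω' : Set (Sym2 W)} {α α'' : Set W}
    (hball : graphBall H z (r + 1) ⊆ enhCluster H r {o} ω' α'')
    (hω : ω ⊆ ω' ∪ edgesInBall H z (r + 1)) (hαsub : α ⊆ α'')
    (hα : ∀ u ∈ α, u ∉ graphBall H z (2 * r + 1)) :
    enhCluster H r {o} ω α ⊆ enhCluster H r {o} ω' α'' := by
  refine enhCluster_subset_of_closed _ (subset_enhCluster _ _ _ _ _) ?_ ?_
  · rintro u v - hu hadj he
    rcases hω he with he' | he'
    · exact mem_enhCluster_of_adj hu hadj he'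
    · exact hball (mk_mem_edgesInBall_iff.1 he').2.2
  · rintro u v - hu hαu hb hd
    have hfar := hα u hαu
    refine mem_enhCluster_of_bonus hu (hαsub hαu) (fun e he => ?_) hd
    rcases hω (hb he) with he' | he'
    · exact he'
    · exfalso
      refine hfar ?_
      have := mem_graphBall_of_edgesInBall_inter he' he
      have h2 : r + 1 + r = 2 * r + 1 := by ring
      rw [h2] at this
      exact this

/-- **Removing marks one at a time** (abstract form): if a monotone property holds for `α` but fails
after deleting the finite set `M`, some `z ∈ M` is pivotal for an intermediate mark set.
[cite: MartineauSevero2019, §6 (proof of Lemma 6.1: "remove from α all the vertices in B_R(e) one by one")] -/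
theorem exists_pivotal_of_remove {β : Type*} [DecidableEq β] (P : Set β → Prop)
    (hP : ∀ a b : Set β, a ⊆ b → P a → P b) (α : Set β) (M : Finset β) (h1 : P α) (h2 : ¬ P (α \ ↑M)) :
    ∃ z ∈ M, ∃ α' : Set β, α \ ↑M ⊆ α' ∧ α' ⊆ α ∧ z ∉ α' ∧ P (insert z α') ∧ ¬ P α' := by
  induction M using Finset.induction_on with
  | empty => simp at h2; exact absurd h1 h2
  | @insert a M ha ih =>
    by_cases hM : P (α \ ↑M)
    · -- deleting `a` after `M` destroys `P`: `a` is pivotal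
      refine ⟨a, Finset.mem_insert_self a M, α \ ↑(insert a M), subset_rfl, Set.sdiff_subset, ?_, ?_, h2⟩
      · simp
      · have haα : a ∈ α := by
          by_contra haα
          refine h2 ?_
          have : α \ ↑(insert a M) = α \ ↑M := by
            ext b
            simp only [Set.mem_sdiff, Finset.coe_insert, Set.mem_insert_iff, not_or]
            constructor
            · rintro ⟨hb, -, hbM⟩; exact ⟨hb, hbM⟩
            · rintro ⟨hb, hbM⟩; exact ⟨hb, fun h => haα (h ▸ hb), hbM⟩
          rw [this]; exact hM
        refine hP _ _ (fun b hb => ?_) hM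
        simp only [Set.mem_insert_iff, Set.mem_sdiff, Finset.coe_insert, not_or]
        rcases hb with ⟨hbα, hbM⟩
        by_cases hba : b = a
        · exact Or.inl hba
        · exact Or.inr ⟨hbα, hba, hbM⟩
    · obtain ⟨z, hz, α', h1', h2', h3', h4', h5'⟩ := ih hM
      refine ⟨z, Finset.mem_insert_of_mem hz, α', ?_, h2', h3', h4', h5'⟩
      refine Set.Subset.trans (fun b hb => ?_) h1'
      simp only [Set.mem_sdiff, Finset.coe_insert, Set.mem_insert_iff, not_or] at hb ⊢
      exact ⟨hb.1, hb.2.2⟩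

end Closure

/-! ### Coordinates -/

section Coord

/-- `enhOmega` of `inl '' ω ∪ inr '' α`. [folklore] -/
@[simp] theorem enhOmega_image_union (ω : Set (Sym2 W)) (α : Set W) :
    enhOmega (Sum.inl '' ω ∪ Sum.inr '' α) = ω := by
  ext e; simp [enhOmega]

/-- `enhAlpha` of `inl '' ω ∪ inr '' α`. [folklore] -/
@[simp] theorem enhAlpha_image_union (ω : Set (Sym2 W)) (α : Set W) :
    enhAlpha (Sum.inl '' ω ∪ Sum.inr '' α) = α := by
  ext v; simp [enhAlpha]

/-- `enhOmega` of `insert (inl e) ξ`. [folklore] -/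
@[simp] theorem enhOmega_insert_inl (e : Sym2 W) (ξ : Set (Sym2 W ⊕ W)) :
    enhOmega (insert (Sum.inl e) ξ) = insert e (enhOmega ξ) := by
  ext f; simp [enhOmega]

/-- `enhAlpha` of `insert (inl e) ξ`. [folklore] -/
@[simp] theorem enhAlpha_insert_inl (e : Sym2 W) (ξ : Set (Sym2 W ⊕ W)) :
    enhAlpha (insert (Sum.inl e) ξ) = enhAlpha ξ := by
  ext v; simp [enhAlpha]

/-- `enhOmega` of `ξ ∖ {inl e}`. [folklore] -/
@[simp] theorem enhOmega_diff_inl (e : Sym2 W) (ξ : Set (Sym2 W ⊕ W)) :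
    enhOmega (ξ \ {Sum.inl e}) = enhOmega ξ \ {e} := by
  ext f; simp [enhOmega]

/-- `enhAlpha` of `ξ ∖ {inl e}`. [folklore] -/
@[simp] theorem enhAlpha_diff_inl (e : Sym2 W) (ξ : Set (Sym2 W ⊕ W)) :
    enhAlpha (ξ \ {Sum.inl e}) = enhAlpha ξ := by
  ext v; simp [enhAlpha]

/-- `enhOmega` of `insert (inr z) ξ`. [folklore] -/
@[simp] theorem enhOmega_insert_inr (z : W) (ξ : Set (Sym2 W ⊕ W)) :
    enhOmega (insert (Sum.inr z) ξ) = enhOmega ξ := by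
  ext f; simp [enhOmega]

/-- `enhAlpha` of `insert (inr z) ξ`. [folklore] -/
@[simp] theorem enhAlpha_insert_inr (z : W) (ξ : Set (Sym2 W ⊕ W)) :
    enhAlpha (insert (Sum.inr z) ξ) = insert z (enhAlpha ξ) := by
  ext v; simp [enhAlpha]

/-- `enhOmega` of `ξ ∖ {inr z}`. [folklore] -/
@[simp] theorem enhOmega_diff_inr (z : W) (ξ : Set (Sym2 W ⊕ W)) :
    enhOmega (ξ \ {Sum.inr z}) = enhOmega ξ := by
  ext f; simp [enhOmega]

/-- `enhAlpha` of `ξ ∖ {inr z}`. [folklore] -/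
@[simp] theorem enhAlpha_diff_inr (z : W) (ξ : Set (Sym2 W ⊕ W)) :
    enhAlpha (ξ \ {Sum.inr z}) = enhAlpha ξ \ {z} := by
  ext v; simp [enhAlpha]

/-- For an increasing event, `i` is pivotal iff the event holds with `i` and fails without it (private
copy of the tree's `isPivotal_iff_of_isUpperSet`, to keep the imports light). [folklore] -/
private theorem isPivotal_iff_of_isUpperSet' {ι : Type*} {A : Set (Set ι)} (hA : IsUpperSet A) (e : ι)
    (ω : Set ι) : IsPivotal A e ω ↔ insert e ω ∈ A ∧ ω \ {e} ∉ A := by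
  unfold IsPivotal
  have hsub : ω \ {e} ⊆ insert e ω := Set.sdiff_subset.trans (Set.subset_insert e ω)
  constructor
  · rintro (⟨h1, h2⟩ | ⟨h1, h2⟩)
    · exact ⟨h1, h2⟩
    · exact absurd (hA hsub h1) h2
  · rintro ⟨h1, h2⟩; exact Or.inl ⟨h1, h2⟩

/-- Membership in `𝓔_L` through `(ω, α)`. [cite: MartineauSevero2019, §6 (𝓔_L)] -/
theorem mem_enhEvent_iff {H : SimpleGraph W} {r : ℕ} {o : W} {L : ℕ} {ξ : Set (Sym2 W ⊕ W)} :
    ξ ∈ enhEvent H r o L ↔ ∃ v, v ∈ enhCluster H r {o} (enhOmega ξ) (enhAlpha ξ) ∧ L ≤ H.dist o v :=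
  Iff.rfl

end Coord

/-! ### The local modification -/

section Modification

variable {H : SimpleGraph W} {r : ℕ}

/-- The **window of the modification** around the edge `e`: edge coordinates within `2r+2` and mark
coordinates within `3r+4` of an endpoint of `e` (Martineau–Severo's `B_R(e)`, `R = 3r+1`, up to the
bookkeeping of our radii). [cite: MartineauSevero2019, Lemma 6.1 (B_R(e))] -/
def modWindow (H : SimpleGraph W) (r : ℕ) (e : Sym2 W) : Set (Sym2 W ⊕ W) :=
  {i | ∃ x ∈ e, i ∈ Sum.inl '' edgesInBall H x (2 * r + 2) ∪ Sum.inr '' graphBall H x (3 * r + 4)}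

/-- An edge coordinate near an endpoint lies in the window. [folklore] -/
theorem inl_mem_modWindow {e : Sym2 W} {x : W} (hx : x ∈ e) {f : Sym2 W}
    (hf : f ∈ edgesInBall H x (2 * r + 2)) : (Sum.inl f : Sym2 W ⊕ W) ∈ modWindow H r e :=
  ⟨x, hx, Or.inl ⟨f, hf, rfl⟩⟩

/-- A mark coordinate near an endpoint lies in the window. [folklore] -/
theorem inr_mem_modWindow {e : Sym2 W} {x : W} (hx : x ∈ e) {v : W}
    (hv : v ∈ graphBall H x (3 * r + 4)) : (Sum.inr v : Sym2 W ⊕ W) ∈ modWindow H r e :=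
  ⟨x, hx, Or.inr ⟨v, hv, rfl⟩⟩

/-- The probability-free content of **Martineau–Severo 2019, Lemma 6.1**, in the configuration
`(ω⁺, α')` after the marks near `e` have been removed: given the pivotal open edge `e = s(x,y)` with
`x ∈ 𝒞_o(ω⁺ ∖ e, α')` (so `dist(o,x) < L`), no mark of `α'` within `3r+2` of `x`, and `L ≥ r+1`, there
are `z ∈ B_r(x)` and `ω'` agreeing with `ω⁺` off `E(B_{r+1}(z))` such that `z ∉ α'`,
`(ω', α') ∉ 𝓔_L` and `(ω', α' ∪ {z}) ∈ 𝓔_L`. [cite: MartineauSevero2019, Lemma 6.1 (proof, Cases a and b)] -/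
theorem exists_center_modification [H.LocallyFinite] (hH : H.Connected) {o : W} {L : ℕ} (hL : r + 1 ≤ L)
    {ω : Set (Sym2 W)} {α : Set W} {x y : W} (hxy : H.Adj x y)
    (hfar : ∃ v, v ∈ enhCluster H r {o} ω α ∧ L ≤ H.dist o v)
    (hnot : ∀ v, v ∈ enhCluster H r {o} (ω \ {s(x, y)}) α → H.dist o v < L)
    (hx : x ∈ enhCluster H r {o} (ω \ {s(x, y)}) α)
    (hα : ∀ u ∈ α, u ∉ graphBall H x (3 * r + 2)) :
    ∃ z ∈ graphBall H x r, ∃ ω' : Set (Sym2 W),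
      (∀ f, f ∉ edgesInBall H z (r + 1) → (f ∈ ω' ↔ f ∈ ω)) ∧ z ∉ α ∧
      (∀ v, v ∈ enhCluster H r {o} ω' α → H.dist o v < L) ∧
      (∃ v, v ∈ enhCluster H r {o} ω' (insert z α) ∧ L ≤ H.dist o v) := by
  -- distances of `x`
  have hxL : H.dist o x < L := hnot x hx
  have hxp : x ∈ enhCluster H r {o} ω α := enhCluster_mono H r subset_rfl Set.sdiff_subset subset_rfl hx
  -- choice of `z` on a geodesic from `o` to `x`
  obtain ⟨z, hz1, hz2⟩ : ∃ z, H.dist o z ≤ L - 1 - r ∧ H.dist z x ≤ r := by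
    obtain ⟨z, h1, h2⟩ := exists_dist_eq_dist_sub hH o x (k := min (H.dist o x) (L - 1 - r)) (min_le_left _ _)
    refine ⟨z, ?_, ?_⟩
    · rw [h1]; exact min_le_right _ _
    · rw [h2]; omega
  have hxz : x ∈ graphBall H z r := mem_graphBall_of_dist_le hH hz2
  have hzx : z ∈ graphBall H x r := mem_graphBall_symm hxz
  -- no marks near `z`
  have hαz : ∀ u ∈ α, u ∉ graphBall H z (2 * r + 1) := fun u hu huz => hα u hu (by
    have := mem_graphBall_trans hzx huz
    have h : r + (2 * r + 1) ≤ 3 * r + 2 := by omega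
    exact graphBall_mono H x h this)
  have hαz' : ∀ u ∈ α, u ∉ graphBall H z (2 * r) := fun u hu huz =>
    hαz u hu (graphBall_mono H z (Nat.le_succ _) huz)
  have hzα : z ∉ α := fun hz => hαz z hz (mem_graphBall_self H z _)
  -- `e ∈ E(B_{r+1}(z))`, so `ω̃ ⊆ ω ∖ e`
  have hein : s(x, y) ∈ edgesInBall H z (r + 1) :=
    ⟨hxy, graphBall_mono H z (Nat.le_succ r) hxz, mem_graphBall_trans hxz (mem_graphBall_one_of_adj' hxy)⟩
  set ωt : Set (Sym2 W) := ω \ edgesInBall H z (r + 1) with hωt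
  have hωt_sub : ωt ⊆ ω \ {s(x, y)} := fun f hf => ⟨hf.1, fun hfe => hf.2 (by
    rw [Set.mem_singleton_iff] at hfe; rw [hfe]; exact hein)⟩
  have hωt_far : ∀ v, v ∈ enhCluster H r {o} ωt α → H.dist o v < L := fun v hv =>
    hnot v (enhCluster_mono H r subset_rfl hωt_sub subset_rfl hv)
  have hωt_no : ∀ f ∈ ωt, f ∉ edgesInBall H z (r + 1) := fun f hf => hf.2
  -- points of `B_r(z)` are at distance `< L`
  have hball_far : ∀ v ∈ graphBall H z r, H.dist o v < L := fun v hv => by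
    have h1 : H.dist o v ≤ H.dist o z + H.dist z v := hH.dist_triangle
    have h2 := dist_le_of_mem_graphBall hv
    omega
  -- first entrance
  have hfe := first_entrance (r := r) hH (z := z) (ω := ω) hαz hxp
  -- the connector edges `F₀` (empty if `o ∈ B_r(z)`), then `F = E(B_r(z)) ∪ F₀`
  obtain ⟨F₀, hF₀1, hF₀2, hF₀3, hF₀4⟩ : ∃ F₀ : Set (Sym2 W),
      (∀ f ∈ F₀, ∀ v ∈ f, v ∈ graphBall H z r ∨ v ∈ enhCluster H r {o} ωt α) ∧
      (∀ f ∈ F₀, ∃ v ∈ f, v ∈ graphBall H z r) ∧ F₀ ⊆ edgesInBall H z (r + 1) ∧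
      ∀ ω' : Set (Sym2 W), ωt ⊆ ω' → F₀ ⊆ ω' → edgesInBall H z r ⊆ ω' → ∀ α'' : Set W, α ⊆ α'' →
        z ∈ enhCluster H r {o} ω' α'' := by
    rcases hfe with ⟨-, hxr⟩ | ⟨u, hu, hdu⟩ | ho
    · exact absurd hxz hxr
    · -- Case a: connector `u⁻ u` with `u ∈ S_{r+1}(z) ∩ 𝒞_o(ω̃, α)`
      obtain ⟨um, hadj, hum⟩ := exists_adj_mem_graphBall_of_dist_eq hH hdu
      refine ⟨{s(um, u)}, ?_, ?_, ?_, ?_⟩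
      · intro f hf v hv
        rw [Set.mem_singleton_iff] at hf
        subst hf
        rcases Sym2.mem_iff.1 hv with rfl | rfl
        · exact Or.inl hum
        · exact Or.inr hu
      · intro f hf
        rw [Set.mem_singleton_iff] at hf
        subst hf
        exact ⟨um, Sym2.mem_mk_left _ _, hum⟩
      · intro f hf
        rw [Set.mem_singleton_iff] at hf
        subst hf
        exact ⟨hadj, graphBall_mono H z (Nat.le_succ r) hum, mem_graphBall_of_dist_le hH hdu.le⟩
      · intro ω' hωt' hF hB α'' hα''
        have hu' : u ∈ enhCluster H r {o} ω' α'' := enhCluster_mono H r subset_rfl hωt' hα'' hu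
        have hum' : um ∈ enhCluster H r {o} ω' α'' :=
          mem_enhCluster_of_adj hu' hadj.symm (by rw [Sym2.eq_swap]; exact hF rfl)
        exact mem_enhCluster_of_mem_graphBall hum' hum hB
    · -- Case b: `o ∈ B_r(z)`, no connector
      refine ⟨∅, by simp, by simp, Set.empty_subset _, ?_⟩
      intro ω' _ _ hB α'' _
      exact mem_enhCluster_of_mem_graphBall (subset_enhCluster _ _ _ _ _ rfl) ho hB
  set F : Set (Sym2 W) := edgesInBall H z r ∪ F₀ with hF
  set ω' : Set (Sym2 W) := ωt ∪ F with hω'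
  have hFsub : F ⊆ edgesInBall H z (r + 1) :=
    Set.union_subset (edgesInBall_mono H z (Nat.le_succ r)) hF₀3
  refine ⟨z, hzx, ω', ?_, hzα, ?_, ?_⟩
  · -- agreement off `E(B_{r+1}(z))`
    intro f hf
    simp only [hω', hωt, Set.mem_union, Set.mem_sdiff]
    constructor
    · rintro (⟨h, -⟩ | h)
      · exact h
      · exact absurd (hFsub h) hf
    · intro h; exact Or.inl ⟨h, hf⟩
  · -- (i) `(ω', α) ∉ 𝓔_L`
    intro v hv
    have hsub := enhCluster_union_subset (r := r) (o := o) (F := F) hωt_no ?_ ?_ hαz' hv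
    · rcases hsub with h | h
      · exact hωt_far v h
      · exact hball_far v h
    · rintro f (hf | hf) v hv
      · left
        have := hf.2
        induction f using Sym2.inductionOn with
        | hf a b =>
          rcases Sym2.mem_iff.1 hv with rfl | rfl
          · exact this.1
          · exact this.2
      · exact hF₀1 f hf v hv
    · rintro f (hf | hf)
      · induction f using Sym2.inductionOn with
        | hf a b => exact ⟨a, Sym2.mem_mk_left _ _, hf.2.1⟩
      · exact hF₀2 f hf
  · -- (ii) `(ω', α ∪ {z}) ∈ 𝓔_L`
    have hB : edgesInBall H z r ⊆ ω' := fun f hf => Or.inr (Or.inl hf)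
    have hz' : z ∈ enhCluster H r {o} ω' (insert z α) :=
      hF₀4 ω' Set.subset_union_left (fun f hf => Or.inr (Or.inr hf)) hB _ (Set.subset_insert _ _)
    have hball : graphBall H z (r + 1) ⊆ enhCluster H r {o} ω' (insert z α) := by
      intro v hv
      by_cases hvr : v ∈ graphBall H z r
      · exact graphBall_subset_enhCluster hz' hB hvr
      · exact mem_enhCluster_of_bonus hz' (Set.mem_insert _ _) hB
          (dist_eq_of_mem_graphBall_of_not_mem hH hv hvr)
    have hωsub : ω ⊆ ω' ∪ edgesInBall H z (r + 1) := fun f hf => by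
      by_cases hfz : f ∈ edgesInBall H z (r + 1)
      · exact Or.inr hfz
      · exact Or.inl (Or.inl ⟨hf, hfz⟩)
    obtain ⟨v, hv, hLv⟩ := hfar
    exact ⟨v, enhCluster_subset_of_ball_subset hball hωsub (Set.subset_insert _ _) hαz hv, hLv⟩

/-- **Martineau–Severo 2019, Lemma 6.1 (local modification), for the enhanced cluster on a connected
locally finite graph, with `L₀ = r + 1`.** If `L ≥ r + 1` and the edge `e` of `H` is `p`-pivotal for `𝓔_L`
in `ξ = (ω, α)`, there are a configuration `ξ'` agreeing with `ξ` off `modWindow H r e`, whose marks are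
marks of `ξ` (marks are only removed), and a vertex `z` within distance `3r+3` of an endpoint of `e` which
is `s`-pivotal for `𝓔_L` in `ξ'`.
[cite: MartineauSevero2019, Lemma 6.1] -/
theorem exists_local_modification [H.LocallyFinite] (hH : H.Connected) {o : W} {L : ℕ} (hL : r + 1 ≤ L)
    {e : Sym2 W} (he : e ∈ H.edgeSet) {ξ : Set (Sym2 W ⊕ W)}
    (hpiv : IsPivotal (enhEvent H r o L) (Sum.inl e) ξ) :
    ∃ ξ' : Set (Sym2 W ⊕ W), ∃ z : W, (∀ i, i ∉ modWindow H r e → (i ∈ ξ' ↔ i ∈ ξ)) ∧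
      (∀ v : W, Sum.inr v ∈ ξ' → Sum.inr v ∈ ξ) ∧
      (∃ x ∈ e, z ∈ graphBall H x (3 * r + 3)) ∧ IsPivotal (enhEvent H r o L) (Sum.inr z) ξ' := by
  classical
  -- unpack pivotality of `e`
  rw [isPivotal_iff_of_isUpperSet' (isUpperSet_enhEvent H r o L)] at hpiv
  obtain ⟨hin, hout⟩ := hpiv
  rw [mem_enhEvent_iff, enhOmega_insert_inl, enhAlpha_insert_inl] at hin
  rw [mem_enhEvent_iff, enhOmega_diff_inl, enhAlpha_diff_inl] at hout
  set ω := enhOmega ξ with hωdef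
  set α := enhAlpha ξ with hαdef
  -- endpoints
  induction e using Sym2.inductionOn with
  | hf x₀ y₀ =>
  have hadj : H.Adj x₀ y₀ := he
  set ω₁ : Set (Sym2 W) := insert s(x₀, y₀) ω with hω₁
  have hω₁diff : ω₁ \ {s(x₀, y₀)} = ω \ {s(x₀, y₀)} := by
    ext f; simp only [hω₁, Set.mem_sdiff, Set.mem_insert_iff, Set.mem_singleton_iff]; tauto
  -- the marks to be removed
  set M : Finset W := ((graphBall_finite H x₀ (3 * r + 3)).inter_of_right α).toFinset with hM
  have hMmem : ∀ v, v ∈ M ↔ v ∈ α ∧ v ∈ graphBall H x₀ (3 * r + 3) := fun v => by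
    rw [hM, Set.Finite.mem_toFinset]; rfl
  set P : Set W → Prop := fun β => ∃ v, v ∈ enhCluster H r {o} ω₁ β ∧ L ≤ H.dist o v with hP
  have hPmono : ∀ a b : Set W, a ⊆ b → P a → P b := fun a b hab ⟨v, hv, hLv⟩ =>
    ⟨v, enhCluster_mono H r subset_rfl subset_rfl hab hv, hLv⟩
  have hP1 : P α := hin
  -- configuration with edges `ω'` and marks `β`
  set cfg : Set (Sym2 W) → Set W → Set (Sym2 W ⊕ W) := fun ω' β => Sum.inl '' ω' ∪ Sum.inr '' β with hcfg
  have hcfg_mem_inl : ∀ (ω' : Set (Sym2 W)) (β : Set W) (f : Sym2 W),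
      (Sum.inl f : Sym2 W ⊕ W) ∈ cfg ω' β ↔ f ∈ ω' := fun ω' β f => by simp [hcfg]
  have hcfg_mem_inr : ∀ (ω' : Set (Sym2 W)) (β : Set W) (v : W),
      (Sum.inr v : Sym2 W ⊕ W) ∈ cfg ω' β ↔ v ∈ β := fun ω' β v => by simp [hcfg]
  have hξ_inl : ∀ f : Sym2 W, (Sum.inl f : Sym2 W ⊕ W) ∈ ξ ↔ f ∈ ω := fun f => Iff.rfl
  have hξ_inr : ∀ v : W, (Sum.inr v : Sym2 W ⊕ W) ∈ ξ ↔ v ∈ α := fun v => Iff.rfl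
  by_cases hP2 : P (α \ ↑M)
  · -- Step 2: the geometric modification in `(ω₁, α')`, `α' = α ∖ M`
    set α' : Set W := α \ ↑M with hα'
    have hα'sub : α' ⊆ α := Set.sdiff_subset
    have hnot : ∀ v, v ∈ enhCluster H r {o} (ω₁ \ {s(x₀, y₀)}) α' → H.dist o v < L := by
      intro v hv
      by_contra hge
      refine hout ⟨v, ?_, not_lt.1 hge⟩
      rw [← hω₁diff]
      exact enhCluster_mono H r subset_rfl subset_rfl hα'sub hv
    -- an endpoint of `e` lies in `𝒞⁻`
    have hend : x₀ ∈ enhCluster H r {o} (ω₁ \ {s(x₀, y₀)}) α' ∨ y₀ ∈ enhCluster H r {o} (ω₁ \ {s(x₀, y₀)}) α' := by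
      by_contra hne
      push Not at hne
      obtain ⟨v, hv, hLv⟩ := hP2
      exact absurd (hnot v (enhCluster_subset_of_endpoints_not_mem hne.1 hne.2 hv)) (not_lt.2 hLv)
    -- name the endpoint in `𝒞⁻` as `x`
    obtain ⟨x, y, hxe, hexy, hx⟩ : ∃ x y : W, x ∈ s(x₀, y₀) ∧ s(x₀, y₀) = s(x, y) ∧
        x ∈ enhCluster H r {o} (ω₁ \ {s(x₀, y₀)}) α' := by
      rcases hend with h | h
      · exact ⟨x₀, y₀, Sym2.mem_mk_left _ _, rfl, h⟩
      · exact ⟨y₀, x₀, Sym2.mem_mk_right _ _, Sym2.eq_swap, h⟩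
    have hxy : H.Adj x y := by
      have : s(x, y) ∈ H.edgeSet := hexy ▸ he
      exact this
    have hx1 : x ∈ graphBall H x₀ 1 := by
      rcases Sym2.mem_iff.1 hxe with rfl | rfl
      · exact mem_graphBall_self H _ 1
      · exact mem_graphBall_one_of_adj' hadj
    have hαx : ∀ u ∈ α', u ∉ graphBall H x (3 * r + 2) := by
      rintro u ⟨huα, huM⟩ hux
      refine huM (Finset.mem_coe.2 ((hMmem u).2 ⟨huα, ?_⟩))
      have := mem_graphBall_trans hx1 hux
      have h : 1 + (3 * r + 2) = 3 * r + 3 := by ring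
      rw [h] at this
      exact this
    rw [hexy] at hx hnot
    obtain ⟨z, hzx, ω', hagree, hzα, hfar1, hfar2⟩ :=
      exists_center_modification hH hL hxy hP2 hnot hx hαx
    refine ⟨cfg ω' α', z, ?_, ?_, ?_, ?_⟩
    · -- agreement off the window
      rintro (f | v) hi
      · rw [hcfg_mem_inl, hξ_inl]
        have hf : f ∉ edgesInBall H z (r + 1) := fun hf => hi (inl_mem_modWindow hxe (by
          obtain ⟨hfadj, hmem⟩ := hf
          refine ⟨hfadj, ?_⟩
          induction f using Sym2.inductionOn with
          | hf a b =>
            have hza : a ∈ graphBall H x (r + (r + 1)) := mem_graphBall_trans hzx hmem.1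
            have hzb : b ∈ graphBall H x (r + (r + 1)) := mem_graphBall_trans hzx hmem.2
            exact ⟨graphBall_mono H x (by omega) hza, graphBall_mono H x (by omega) hzb⟩))
        rw [hagree f hf, hω₁, Set.mem_insert_iff]
        constructor
        · rintro (rfl | h)
          · exfalso
            refine hi (inl_mem_modWindow (Sym2.mem_mk_left x₀ y₀) ⟨hadj, mem_graphBall_self H _ _, ?_⟩)
            exact graphBall_mono H x₀ (by omega) (mem_graphBall_one_of_adj' hadj)
          · exact h
        · exact fun h => Or.inr h
      · rw [hcfg_mem_inr, hξ_inr, hα']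
        simp only [Set.mem_sdiff, Finset.mem_coe, hMmem, not_and]
        constructor
        · exact fun h => h.1
        · intro hv
          refine ⟨hv, fun _ hv3 => hi (inr_mem_modWindow (Sym2.mem_mk_left x₀ y₀) ?_)⟩
          exact graphBall_mono H x₀ (by omega) hv3
    · -- marks are only removed
      intro v hv
      rw [hcfg_mem_inr] at hv
      exact (hξ_inr v).2 (hα'sub hv)
    · refine ⟨x, hxe, graphBall_mono H x (by omega) hzx⟩
    · -- `z` is `s`-pivotal in `(ω', α')`
      rw [isPivotal_iff_of_isUpperSet' (isUpperSet_enhEvent H r o L), mem_enhEvent_iff, mem_enhEvent_iff,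
        enhOmega_insert_inr, enhAlpha_insert_inr, enhOmega_diff_inr, enhAlpha_diff_inr]
      simp only [hcfg, enhOmega_image_union, enhAlpha_image_union]
      refine ⟨hfar2, ?_⟩
      rintro ⟨v, hv, hLv⟩
      have : α' \ {z} = α' := by
        ext u; simp only [Set.mem_sdiff, Set.mem_singleton_iff, and_iff_left_iff_imp]
        rintro hu rfl; exact hzα hu
      rw [this] at hv
      exact absurd (hfar1 v hv) (not_lt.2 hLv)
  · -- Step 1: a removed mark is pivotal
    obtain ⟨z, hzM, α'', h1, h2, h3, h4, h5⟩ := exists_pivotal_of_remove P hPmono α M hP1 hP2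
    refine ⟨cfg ω₁ α'', z, ?_, ?_, ?_, ?_⟩
    · rintro (f | v) hi
      · rw [hcfg_mem_inl, hξ_inl, hω₁, Set.mem_insert_iff]
        constructor
        · rintro (rfl | h)
          · exfalso
            refine hi (inl_mem_modWindow (Sym2.mem_mk_left x₀ y₀) ⟨hadj, mem_graphBall_self H _ _, ?_⟩)
            exact graphBall_mono H x₀ (by omega) (mem_graphBall_one_of_adj' hadj)
          · exact h
        · exact fun h => Or.inr h
      · rw [hcfg_mem_inr, hξ_inr]
        constructor
        · exact fun h => h2 h
        · intro hv
          refine h1 ⟨hv, fun hvM => hi (inr_mem_modWindow (Sym2.mem_mk_left x₀ y₀) ?_)⟩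
          exact graphBall_mono H x₀ (by omega) ((hMmem v).1 (Finset.mem_coe.1 hvM)).2
    · intro v hv
      rw [hcfg_mem_inr] at hv
      exact (hξ_inr v).2 (h2 hv)
    · exact ⟨x₀, Sym2.mem_mk_left _ _, ((hMmem z).1 hzM).2⟩
    · rw [isPivotal_iff_of_isUpperSet' (isUpperSet_enhEvent H r o L), mem_enhEvent_iff, mem_enhEvent_iff,
        enhOmega_insert_inr, enhAlpha_insert_inr, enhOmega_diff_inr, enhAlpha_diff_inr]
      simp only [hcfg, enhOmega_image_union, enhAlpha_image_union]
      refine ⟨h4, ?_⟩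
      have : α'' \ {z} = α'' := by
        ext u; simp only [Set.mem_sdiff, Set.mem_singleton_iff, and_iff_left_iff_imp]
        rintro hu rfl; exact h3 hu
      rw [this]
      exact h5

end Modification

end Literature.Probability.Percolation
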